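/-
Copyright (c) 2026. All rights reserved.
Released under Apache 2.0 license as described in the file LICENSE.
Authors: HodgeCM publication cell (pub-hodgecm), GR lane, seat GR-2 (`pub-hodgecm-own-hyp34`).
-/
import Literature.NumberTheory.Weil1964.AdelicMetaplecticProjSurjective
import HarnessLib

/-!
# `Mp_ψ(W_𝐀)ᶜᵒⁿᵗ` is generated by the Levi, unipotent and Weyl pairs together with the scalars

Topic `NumberTheory/Weil1964`; namespace `Literature.NumberTheory.Weil1964`.  KERNEL ONLY: theorems, no definition,
nothing of [Weil1964] asserted.

[Weil1964, Chap. I n° 13 p. 160] writes the metaplectic operators on the generators of the symplectic group (`d(α)`,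
`t(f)`, `d'(γ)`: Levi, second-degree character, Fourier transform) and [MoeglinVignerasWaldspurger1987, Chap. 2 II.6]
records that these, with the central scalars of the exact sequence (B) `1 → ℂˣ → S̃p_ψ(W) → Sp(W) → 1`, determine
everything.  For the tree's adelic metaplectic group of record `Mp_ψ(W_𝐀)ᶜᵒⁿᵗ = adelicMpCont F (Fin n) T` (Gram matrix
`T`, `IsUnit T.det`) this file proves the corresponding STRUCTURE THEOREM:

* **`adelicMpCont.eq_top_of_generators_mem`**: a subgroup of `Mp_ψ(W_𝐀)ᶜᵒⁿᵗ` containing the Levi pairs `leviPair a`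
  (`a ∈ GL_n(𝐀_F)`), the unipotent pairs `unipPair c` (`c ∈ Sym_n(𝐀_F)`), the Weyl pair `weylPair ν` (one self-dual
  Haar measure `ν`) and the scalars `ofScalar c` (`c ∈ ℂˣ`) is everything;
* **`adelicMpCont.induction_on_generators`**: a multiplicative property (stable under products and inverses, true at
  `1`) holds on all of `Mp_ψ(W_𝐀)ᶜᵒⁿᵗ` as soon as it holds on these generators — the form in which "every metaplectic
  operator is `c ·` a product of explicit operators" is consumed (e.g. `L²`-isometry up to a positive scalar);
* **`adelicMpCont.hom_ext_generators`**: two homomorphisms out of `Mp_ψ(W_𝐀)ᶜᵒⁿᵗ` agreeing on these generators coincide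
  (uniqueness of `Mp` legs, of twists).

Proof: `π(H)` contains the images `m(a)`, `v(c)`, `J` of the Siegel generators of `Sp_{2n}(𝐀_F)`, hence all of
`Sp(W_𝐀)` (`AdeleRingSymplecticGeneration`, transport onto: `SchrodingerPiGeneration.transportSp_surjective`); so every
`p` agrees under `π` with some `q ∈ H`, and `p q⁻¹ ∈ ker π = ℂˣ·(1, id)` (`AdelicMetaplecticKernel`).

## References
* [Weil1964] A. Weil, Acta Math. 111 (1964) 143–211, Chap. I n° 13 p. 160, Chap. III n° 37 p. 188.
* [MoeglinVignerasWaldspurger1987] C. Mœglin, M.-F. Vignéras, J.-L. Waldspurger, LNM 1291 (1987), Chap. 2 II.1 (B),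
  II.5–II.6.
-/

set_option autoImplicit false

noncomputable section

open scoped Matrix
open NumberField MeasureTheory

namespace Literature.NumberTheory.Weil1964

open Literature.NumberTheory.Automorphic Literature.RepresentationTheory.HeisenbergGroup
  Literature.RepresentationTheory.HeisenbergGroup.SymplecticMatrix

variable (F : Type) [Field F] [NumberField F] {n : ℕ}
variable (T : Matrix (Fin n) (Fin n) (AdeleRing (𝓞 F) F)) (hT : IsUnit T.det)
variable [MeasurableSpace (AdeleRing (𝓞 F) F)] [BorelSpace (AdeleRing (𝓞 F) F)]
  (ν : Measure (Fin n → AdeleRing (𝓞 F) F)) [ν.IsAddHaarMeasure] (hν : ν (piFundamentalDomain F (Fin n)) = 1)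

include hT in
/-- **`Mp_ψ(W_𝐀)ᶜᵒⁿᵗ = ⟨leviPair, unipPair, weylPair, ℂˣ⟩`**: a subgroup of the adelic metaplectic group of record containing
every Levi pair `leviPair a` (`a ∈ GL_n(𝐀_F)`), every unipotent pair `unipPair c` (`c ∈ Sym_n(𝐀_F)`), the Weyl pair of a
self-dual Haar measure and every scalar `(1, c·id)` is the whole group.
[cite: Weil1964, Chap. I n° 13 p. 160, Chap. III n° 37 p. 188; MoeglinVignerasWaldspurger1987, Chap. 2 II.1 (B), II.6] -/
theorem adelicMpCont.eq_top_of_generators_mem {H : Subgroup (adelicMpCont F (Fin n) T)}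
    (hm : ∀ a : GL (Fin n) (AdeleRing (𝓞 F) F),
      (⟨leviPair F T hT a, leviPair_mem_adelicMpCont F T hT a⟩ : adelicMpCont F (Fin n) T) ∈ H)
    (hv : ∀ (c : Matrix (Fin n) (Fin n) (AdeleRing (𝓞 F) F)) (hc : c.IsSymm),
      (⟨unipPair F T hT c hc, unipPair_mem_adelicMpCont F T hT c hc⟩ : adelicMpCont F (Fin n) T) ∈ H)
    (hJ : (⟨weylPair F T hT ν hν, weylPair_mem_adelicMpCont F T hT ν hν⟩ : adelicMpCont F (Fin n) T) ∈ H)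
    (hs : ∀ c : ℂˣ, adelicMpCont.ofScalar F (Fin n) T c ∈ H) : H = ⊤ := by
  rw [eq_top_iff]
  rintro p -
  -- `π(H)` contains the transported Siegel generators, hence all of `Sp(W_𝐀)`
  have hK : (transportSp T hT).range ≤ H.map (adelicMpCont.proj F (Fin n) T) :=
    range_le_of_generators_mem_adeleRing' F (transportSp T hT) (K := H.map (adelicMpCont.proj F (Fin n) T))
      (fun a => ⟨_, hm a, (proj_leviPair F T hT a).trans (transportSp_levi T hT a).symm⟩)
      (fun c hc => ⟨_, hv c hc, (proj_unipPair F T hT c hc).trans (transportSp_low T hT c hc).symm⟩)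
      ⟨_, hJ, (proj_weylPair F T hT ν hν).trans (transportSp_J T hT).symm⟩
  have hsurj := Literature.RepresentationTheory.HeisenbergGroup.transportSp_surjective T hT
    (adelicMpCont.proj F (Fin n) T p)
  refine hsurj.elim fun A hA => ?_
  have hp : adelicMpCont.proj F (Fin n) T p ∈ H.map (adelicMpCont.proj F (Fin n) T) := hK ⟨A, hA⟩
  refine (Subgroup.mem_map.1 hp).elim fun q hq => ?_
  -- `p q⁻¹ ∈ ker π` is a scalar
  have h1 : adelicMpCont.proj F (Fin n) T (p * q⁻¹) = 1 := by
    simp only [map_mul, map_inv, hq.2, mul_inv_cancel]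
  refine (adelicMpCont.exists_eq_ofScalar_of_proj_eq_one ((Matrix.isUnit_iff_isUnit_det T).2 hT) (p * q⁻¹) h1).elim
    fun c hc => ?_
  have h2 : adelicMpCont.ofScalar F (Fin n) T c * q = p := by
    rw [← hc, inv_mul_cancel_right]
  rw [← h2]
  exact H.mul_mem (hs c) hq.1

include hT in
/-- **induction on generators for `Mp_ψ(W_𝐀)ᶜᵒⁿᵗ`**: a property of elements of the adelic metaplectic group of record that
holds at `1`, is stable under products and inverses, and holds on the Levi pairs, the unipotent pairs, the Weyl pair of a
self-dual Haar measure and the scalars, holds everywhere — every LF-continuous metaplectic operator is a scalar times a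
product of the explicit operators `Φ ↦ Φ ∘ a⁻¹`, `Φ ↦ ψ(-½ ᵗu c u) Φ`, `Φ ↦ Φ̂(-·)` and their inverses.
[cite: Weil1964, Chap. I n° 13 p. 160, Chap. III n° 37 p. 188; MoeglinVignerasWaldspurger1987, Chap. 2 II.6] -/
theorem adelicMpCont.induction_on_generators {P : adelicMpCont F (Fin n) T → Prop}
    (h1 : P 1) (hmul : ∀ p q, P p → P q → P (p * q)) (hinv : ∀ p, P p → P p⁻¹)
    (hm : ∀ a : GL (Fin n) (AdeleRing (𝓞 F) F), P ⟨leviPair F T hT a, leviPair_mem_adelicMpCont F T hT a⟩)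
    (hv : ∀ (c : Matrix (Fin n) (Fin n) (AdeleRing (𝓞 F) F)) (hc : c.IsSymm),
      P ⟨unipPair F T hT c hc, unipPair_mem_adelicMpCont F T hT c hc⟩)
    (hJ : P ⟨weylPair F T hT ν hν, weylPair_mem_adelicMpCont F T hT ν hν⟩)
    (hs : ∀ c : ℂˣ, P (adelicMpCont.ofScalar F (Fin n) T c)) (p : adelicMpCont F (Fin n) T) : P p := by
  let H : Subgroup (adelicMpCont F (Fin n) T) :=
    { carrier := {p | P p}
      mul_mem' := fun {a b} ha hb => hmul a b ha hb
      one_mem' := h1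
      inv_mem' := fun {a} ha => hinv a ha }
  have hH : H = ⊤ := adelicMpCont.eq_top_of_generators_mem F T hT ν hν (H := H) hm hv hJ hs
  have hp : p ∈ H := by rw [hH]; exact Subgroup.mem_top p
  exact hp


include hT in
/-- **two homomorphisms out of `Mp_ψ(W_𝐀)ᶜᵒⁿᵗ` that agree on the Levi pairs, the unipotent pairs, the Weyl pair of a
self-dual Haar measure and the scalars are equal** — e.g. two `Mp` legs into print's `Mp_𝐀(W)`, or two twists of the
Weil representation. [cite: Weil1964, Chap. I n° 13 p. 160; MoeglinVignerasWaldspurger1987, Chap. 2 II.6] -/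
theorem adelicMpCont.hom_ext_generators {G : Type*} [Group G] {φ ψ : adelicMpCont F (Fin n) T →* G}
    (hm : ∀ a : GL (Fin n) (AdeleRing (𝓞 F) F),
      φ ⟨leviPair F T hT a, leviPair_mem_adelicMpCont F T hT a⟩ = ψ ⟨leviPair F T hT a, leviPair_mem_adelicMpCont F T hT a⟩)
    (hv : ∀ (c : Matrix (Fin n) (Fin n) (AdeleRing (𝓞 F) F)) (hc : c.IsSymm),
      φ ⟨unipPair F T hT c hc, unipPair_mem_adelicMpCont F T hT c hc⟩ =
        ψ ⟨unipPair F T hT c hc, unipPair_mem_adelicMpCont F T hT c hc⟩)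
    (hJ : φ ⟨weylPair F T hT ν hν, weylPair_mem_adelicMpCont F T hT ν hν⟩ =
      ψ ⟨weylPair F T hT ν hν, weylPair_mem_adelicMpCont F T hT ν hν⟩)
    (hs : ∀ c : ℂˣ, φ (adelicMpCont.ofScalar F (Fin n) T c) = ψ (adelicMpCont.ofScalar F (Fin n) T c)) : φ = ψ :=
  MonoidHom.eq_of_eqOn_top fun p _ => by
    have h : p ∈ φ.eqLocus ψ := by
      rw [adelicMpCont.eq_top_of_generators_mem F T hT ν hν (H := φ.eqLocus ψ) hm hv hJ hs]
      exact Subgroup.mem_top p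
    exact h

end Literature.NumberTheory.Weil1964

end
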